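import Summits.BirchSwinnertonDyer.BirchSwinnertonDyer.Theorems.PrintX11aUpperNonSurjThreeSharpTame
import Literature.NumberTheory.EllipticCurves.TateCurve.NumberFieldUniformization
import Summits.BirchSwinnertonDyer.BirchSwinnertonDyer.Theorems.PrintX11aUpperNonSurjThreeSharpLocalKummer
import Literature.NumberTheory.EllipticCurves.GeomPointsGaloisModule
import HarnessLib

/-!
# Route `PrintX11a`, child crux U3 = `PrintX11a.UpperNonSurjThree` (item stmt-BirchSwinnertonDyer-20613),
# line «finemu3» — ♯-road LOCAL FINITENESS II: **tower torsion at a SPLIT multiplicative place is level-0 torsion**.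
# For ANY `ℤ_p`-extension `κ` of a number field `K`, an elliptic `W/K` split multiplicative at `v` with `μ_p(K_v) = 1`
# (and a tame exponent on `E[p]`): `E[p^∞]^{Gal(K̄/K_∞) ⊓ D_v} = E[p^∞]^{D_v}` («`E(K_{v,∞})[p^∞] = E(K_v)[p^∞]`»), from
# the tree's Tate uniformisation; hence the ♯-clause at `v` in EXPLICIT form «`y_v = ∂b + χ`» with `p·b ∈ E(K_v)[p^∞]`
# and `χ : D_v → E(K_v)[p]` a homomorphism killing `Gal(K̄_v/K_v K_∞)` — the `B_v` of REF's audit note V14 at the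
# split-at-`3` U3 pairs and at split `ℓ ∈ {2, 5}`
# (cell `bsd-print-x11a`, width seat `bsd-line-x11a-p1-w2` gen 2; `--supports` 20613; closes nothing)

HONEST FRAMING.  BSD is not proved by any of this; nothing is asserted about any curve; the crux and `stub_conjA_three`
stay OPEN.  THEOREMS ONLY (no definition, no named fact, no `sorry`), all PROVED from tree theorems (Tate uniformisation
`TateCurve.Silverman1994_thmV53_tateUniformisation_holds`, Silverman ATAEC V.3.1/V.5.3, DISCHARGED in the tree).

WHY.  After `…SharpTame` (p615486) the only tower-level object left in a per-pair (A)-certificate is the tower torsion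
`E[p^∞]^{H_v}`, `H_v = Gal(K̄/K_∞) ⊓ D_v`, at the places with `E(K_v)[p] ≠ 0`.  At a SPLIT multiplicative place it does not grow:
* §1 (abstract): `N ⊓ D` normalised by `D`, `A ⊆ M` without non-zero `N ⊓ D`-fixed element, `d • m − m ∈ A` for `d ∈ D` ⟹
  (`m` fixed by `N ⊓ D` ⟹ `m` fixed by `D`).
* §2 `geomPrimaryTorsion_forall_decomp_smul_eq_of_split` — THE THEOREM (split `v`, `μ_p(K_v) = 1`, tame exponent on `E[p]`):
  with Tate's `Φ : K̄_vˣ ↠ E(K̄_v)` (kernel `q^ℤ`, equivariant, fixed points from `K_vˣ` — tree) and `A` = preimage of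
  `Φ(μ_{p^∞})`: (F1) `D_v` acts trivially modulo `A` (`σP − P ↦ Φ(σu/u)`, `(σu/u)^{p^k} = σ(q^n)/q^n = 1`); (F2) no non-zero
  `H_v`-fixed point in `A` (a `p`-torsion one is `D_v`-fixed by the TAME TRANSFER of `…SharpTame`, so `Φ(ζ) = Φ(u)`,
  `u ∈ K_vˣ`, `ζ = u qⁿ ∈ K_v`, `ζ^{p^k} = 1 ⟹ ζ = 1`; induction on the exponent).  Then
  `exists_kummer_add_hom_of_sharp_clause_of_split`: the ♯-clause at `v` in the explicit form «`y_v = ∂b + χ`».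
* §3 over `ℚ` (`E[p]` irreducible, `ρ̄` not onto: tame exponent automatic): `E(ℚ_{v,∞})[p^∞] = E(ℚ_v)[p^∞]` at split `v` with
  `μ_p(ℚ_v) = 1`, every `κ`; ♯0 doors displaying `T` (places with `E(ℚ_v)[p] = 0`: clause «`y_v = 0`») and `T'` (split,
  `μ_p(ℚ_v) = 1`: clause «`y_v = ∂b + χ`»).
ENGINE READING.  At `v ∈ T'` a candidate `y ≠ 0` is refuted by checking that no `b` with `p·b ∈ E(ℚ_v)[p^∞]` (finite:
`p`-division points of `{x ∈ ℚ_vˣ : x^{p^m} ∈ q^ℤ}/q^ℤ`, mod `E[p]`) and no homomorphism `χ : D_v → E(ℚ_v)[p]` trivial on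
`Gal(ℚ̄_v/ℚ_v ℚ_∞)` (so `χ = λ_v ⊗ t` through the first local layer, cyclic of order `p`) give `y_v = ∂b + χ`.  U3: `(3) ∈ T'` at
the 5 split-at-3 pairs; `(2), (5) ∈ T'` when split (`2, 5 ≢ 1 (3)`).  NOT covered (honest): `E(ℚ_v)[p] ≠ 0` at non-split
`ℓ ≡ −1 (p)` (infinite tower torsion) or additive `v`; the identification of `D_v/(D_v^p H_v)` with the first local layer.

References: [GreenbergLNM1716] §3 Lemmas 3.1, 3.3 (`ker r_v` via `E(F_{∞,η})[p^∞]`; Tate curves at split `v ∣ p`,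
p. 70); [SilvermanATAEC1994] Thm. V.3.1 (c)(d), Lemma V.5.2, Thm. V.5.3 (Tate uniformisation, `E_q[p^∞] = ⟨μ_{p^∞}, q^{1/p^∞}⟩`);
[CoatesSujatha2005] §3 statement (A); [DeoRaySujatha2023] §3 (c3); [Serre1972] §2.4 Prop. 15; REF STATUS
2026-08-28T06:26:48Z (V14 «explicit B_v at v ∈ S»), 07:20:16Z (V26).
-/

set_option linter.dupNamespace false
set_option autoImplicit false

noncomputable section

open scoped Classical

open WeierstrassCurve Field NumberField IsDedekindDomain
  Literature.NumberTheory.EllipticCurves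
  Literature.NumberTheory.EllipticCurves.GreenbergSelmer
  Literature.NumberTheory.EllipticCurves.Rank1Residual
  Literature.NumberTheory.GaloisRepresentations
  Summit.BirchSwinnertonDyer.Rank1Residual

namespace Summit.BirchSwinnertonDyer.BirchSwinnertonDyer.Theorems.UpperNonSurjThreeSharp

/-! ### §1 Abstract: a subgroup `N ⊓ D` of `D` normalised by `D` sees the `D`-fixed points when `D` acts trivially modulo a
sub-object without `N ⊓ D`-fixed points -/

section Abstract

variable {G : Type*} [Group G] {M : Type*} [AddCommGroup M] [DistribMulAction G M]

/-- **Abstract descent through a quotient with trivial action.**  `N, D ≤ G` with `N ⊓ D` normalised by `D`; `A ⊆ M` with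
no non-zero `N ⊓ D`-fixed element; `m ∈ M` with `d • m − m ∈ A` for all `d ∈ D`.  If `m` is fixed by `N ⊓ D` then `m` is
fixed by `D` (`d • m − m` is `N ⊓ D`-fixed since `n d = d (d⁻¹ n d)`, hence `0`). [cite: GreenbergLNM1716, §3 Lemma 3.3 (proof pattern)] -/
theorem smul_eq_of_fixed_inf_of_sub_mem (N D : Subgroup G)
    (hN : ∀ d ∈ D, ∀ n ∈ N ⊓ D, d⁻¹ * n * d ∈ N ⊓ D) (A : Set M)
    (hA0 : ∀ a ∈ A, (∀ n ∈ N ⊓ D, n • a = a) → a = 0) {m : M}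
    (hA : ∀ d ∈ D, d • m - m ∈ A) (hm : ∀ n ∈ N ⊓ D, n • m = m) : ∀ d ∈ D, d • m = m := by
  intro d hd
  have key : d • m - m = 0 := by
    refine hA0 _ (hA d hd) fun n hn ↦ ?_
    have h1 : (n * d) • m = d • m := by
      rw [show n * d = d * (d⁻¹ * n * d) by group, mul_smul, hm _ (hN d hd n hn)]
    rw [smul_sub, ← mul_smul, h1, hm n hn]
  exact sub_eq_zero.mp key

end Abstract

/-! ### §2 Tate uniformisation: `E[p^∞]^{Gal(K̄/K_∞) ⊓ D_v} = E[p^∞]^{D_v}` at a split multiplicative place with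
`μ_p(K_v) = 1` (and a tame exponent on `E[p]`) -/

section Split

variable {K : Type} [Field K] [NumberField K] (W : WeierstrassCurve K) [W.IsElliptic] {p : ℕ} [Fact p.Prime]
  (κ : ZpExtension K p)

omit [Fact p.Prime] in
/-- `μ_p(F) = 1 ⟹ μ_{p^k}(F) = 1` (induction on `k`). [folklore] -/
theorem pow_prime_pow_eq_one_imp {F : Type*} [Monoid F] (hμ : ∀ ζ : F, ζ ^ p = 1 → ζ = 1) :
    ∀ (k : ℕ) (ζ : F), ζ ^ p ^ k = 1 → ζ = 1 := by
  intro k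
  induction k with
  | zero => intro ζ h; simpa using h
  | succ k ih =>
    intro ζ h
    rw [pow_succ, pow_mul] at h
    exact ih ζ (by rw [hμ _ h])

/-- **TOWER TORSION AT A SPLIT MULTIPLICATIVE PLACE IS LEVEL-0 TORSION.**  `K` a number field, `W/K` elliptic, SPLIT
multiplicative at `v`, `μ_p(K_v) = 1` (`∀ ζ ∈ K_v, ζ^p = 1 → ζ = 1`), a tame exponent on `E[p]` at `D_v` (automatic when
`p ∤ #ρ̄_{E,p}(Γ_K)`).  Then for EVERY `ℤ_p`-datum `κ` a point of `E[p^∞]` fixed by `Gal(K̄/K_∞) ⊓ D_v` is fixed by `D_v`: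
`E(K_{v,∞})[p^∞] = E(K_v)[p^∞]` above `v`.  (Tate's `Φ`, tree-discharged: `D_v` acts trivially on `E[p^∞]/Φ(μ_{p^∞})`, and
`Φ(μ_{p^∞})` has no non-zero tower-fixed point — tame transfer + fixed points of `Φ` come from `K_vˣ` + `μ_p(K_v) = 1`.)
[cite: SilvermanATAEC1994, Thm. V.3.1 (c)(d), Lemma V.5.2, Thm. V.5.3] [cite: GreenbergLNM1716, §3 Lemma 3.3 and p. 70 (Tate period at split `v`)] -/
theorem geomPrimaryTorsion_forall_decomp_smul_eq_of_split (v : HeightOneSpectrum (𝓞 K))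
    (hsplit : W.HasSplitMultiplicativeReductionAt v)
    (hμ : ∀ ζ : v.adicCompletion K, ζ ^ p = 1 → ζ = 1)
    (htame : ∀ σ ∈ decomp v, ∃ m : ℕ, p.Coprime m ∧ ∀ Q : geomTorsion W (p : ℤ), σ ^ m • Q = Q)
    (P : geomPrimaryTorsion W p) (hP : ∀ τ ∈ κ.kerSubgroup ⊓ decomp v, τ • P = P) :
    ∀ σ ∈ decomp v, σ • P = P := by
  have hp : p.Prime := Fact.out
  set Kv := v.adicCompletion K with hKv
  haveI : CharZero Kv := charZero_adicCompletion v
  obtain ⟨q, Φ, hq0, -, hsurj, hker, hequiv, hrat⟩ :=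
    TateCurve.Silverman1994_thmV53_tateUniformisation_holds W v hsplit
  set L := AlgebraicClosure Kv with hL
  -- the `μ`-line: points of `E[p^∞]` whose image in `E(K̄_v)` is `Φ(ζ)` for a `p`-power root of unity `ζ`
  set A : Set (geomPrimaryTorsion W p) := {x | ∃ ζ : Lˣ, (∃ k : ℕ, (ζ : L) ^ p ^ k = 1) ∧
    pointsMap W Kv (x : geomPoints W) = Φ (Additive.ofMul ζ)} with hA
  -- (F1) `D_v` acts trivially on `E[p^∞]` modulo `A`
  have hF1 : ∀ d ∈ decomp v, ∀ x : geomPrimaryTorsion W p, d • x - x ∈ A := by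
    intro d hd x
    obtain ⟨σ, rfl⟩ := (mem_decomp_iff v d).mp hd
    obtain ⟨k, hk⟩ := x.2
    obtain ⟨a, ha⟩ := hsurj (pointsMap W Kv (x : geomPoints W))
    obtain ⟨u, rfl⟩ : ∃ u : Lˣ, Additive.ofMul u = a := ⟨Additive.toMul a, rfl⟩
    -- `u^{p^k} = q^n`
    have hux : Φ (Additive.ofMul (u ^ p ^ k)) = 0 := by
      have hx0 : (p ^ k • x : geomPrimaryTorsion W p) = 0 := Subtype.ext (by
        rw [AddSubgroupClass.coe_nsmul, hk]; rfl)
      rw [ofMul_pow, map_nsmul, ha, ← map_nsmul, ← AddSubgroupClass.coe_nsmul, hx0, ZeroMemClass.coe_zero,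
        map_zero]
    obtain ⟨n, hn⟩ := (hker _).mp hux
    rw [Units.val_pow_eq_pow_val] at hn
    set σ' : L →* L := (absoluteGaloisGroup.toAlgEquiv Kv σ : L →* L) with hσ'
    refine ⟨Units.map σ' u * u⁻¹, ⟨k, ?_⟩, ?_⟩
    · rw [Units.val_mul, mul_pow, Units.val_inv_eq_inv_val, inv_pow, Units.coe_map, ← map_pow, hn, hσ',
        MonoidHom.coe_coe, map_zpow₀, AlgEquiv.commutes, mul_inv_cancel₀]
      exact zpow_ne_zero n ((_root_.map_ne_zero _).mpr hq0)
    · rw [AddSubgroupClass.coe_sub, map_sub, primaryComponent.coe_smul, ← resGal_eq_absGaloisRestrict,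
        pointsMap_smul, ← ha, hequiv, ofMul_mul, ofMul_inv, map_add, map_neg, sub_eq_add_neg]
  -- (F2) no non-zero point of `A` is fixed by `H_v = ker κ ⊓ D_v`
  -- first for `p`-torsion points (tame transfer to `D_v`, then `Γ_{K_v}`-fixed points of `Φ` come from `K_vˣ`)
  have hF2p : ∀ a ∈ A, p • a = 0 → (∀ τ ∈ κ.kerSubgroup ⊓ decomp v, τ • a = a) → a = 0 := by
    intro a haA hpa hfix
    -- tame transfer: `a` is `D_v`-fixed
    have hDfix : ∀ σ ∈ decomp v, σ • a = a := by
      intro σ hσ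
      obtain ⟨m, hm, hσm⟩ := htame σ hσ
      refine geomPrimaryTorsion_smul_eq_of_forall_kerSubgroup_inf_decomp W κ v a hfix hσ hm ?_
      have hmem : ((a : geomPrimaryTorsion W p) : geomPoints W) ∈ geomTorsion W (p : ℤ) :=
        AddSubgroup.torsionBy.nsmul_iff.mpr (by
          rw [← AddSubgroupClass.coe_nsmul, hpa, ZeroMemClass.coe_zero])
      have := hσm ⟨_, hmem⟩
      apply Subtype.ext
      rw [primaryComponent.coe_smul]
      simpa [Literature.NumberTheory.EllipticCurves.AddSubgroup.torsionBy.coe_smul] using congrArg Subtype.val this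
    obtain ⟨ζ, ⟨k, hζk⟩, hζ⟩ := haA
    -- `Φ(ζ)` is `Γ_{K_v}`-fixed, hence `Φ(u)` for `u ∈ K_vˣ`
    have hfixloc : ∀ σ : absoluteGaloisGroup Kv, σ • pointsMap W Kv (a : geomPoints W) =
        pointsMap W Kv (a : geomPoints W) := by
      intro σ
      have h := hDfix (absGaloisRestrict K Kv σ) ⟨σ, rfl⟩
      rw [← pointsMap_smul, resGal_eq_absGaloisRestrict, ← primaryComponent.coe_smul, h]
    obtain ⟨u, hu⟩ := hrat _ hfixloc
    -- `ζ / u ∈ q^ℤ`, so `ζ = u q^n ∈ K_v`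
    have h0 : Φ (Additive.ofMul (ζ * (Units.map (algebraMap Kv L : Kv →* L) u)⁻¹)) = 0 := by
      rw [ofMul_mul, ofMul_inv, map_add, map_neg, hu, ← hζ, add_neg_cancel]
    obtain ⟨n, hn⟩ := (hker _).mp h0
    have hU0 : algebraMap Kv L (u : Kv) ≠ 0 := (_root_.map_ne_zero _).mpr u.ne_zero
    have hζeq : (ζ : L) = algebraMap Kv L ((u : Kv) * q ^ n) := by
      rw [map_mul, map_zpow₀, ← hn, Units.val_mul, Units.val_inv_eq_inv_val, Units.coe_map,
        MonoidHom.coe_coe, mul_left_comm, mul_inv_cancel₀ hU0, mul_one]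
    have hζ0 : ((u : Kv) * q ^ n) ^ p ^ k = 1 := by
      apply (algebraMap Kv L).injective
      rw [map_pow, ← hζeq, hζk, map_one]
    have hζ1 : (ζ : L) = 1 := by rw [hζeq, pow_prime_pow_eq_one_imp hμ k _ hζ0, map_one]
    have hpa0 : pointsMap W Kv (a : geomPoints W) = 0 := by
      rw [hζ, show ζ = 1 from Units.ext hζ1, ofMul_one, map_zero]
    have ha0 : (a : geomPoints W) = 0 := pointsMapOfEmb_injective W (closureEmb (K := K) Kv) (by
      change pointsMap W Kv (a : geomPoints W) = pointsMap W Kv 0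
      rw [hpa0, map_zero])
    exact Subtype.ext (by rw [ha0, ZeroMemClass.coe_zero])
  -- then for all of `A` by induction on the exponent (`A` is stable under multiplication by `p`)
  have hF2 : ∀ a ∈ A, (∀ τ ∈ κ.kerSubgroup ⊓ decomp v, τ • a = a) → a = 0 := by
    intro a haA hfix
    obtain ⟨j, hj⟩ := a.2
    have hpj : p ^ j • a = 0 := Subtype.ext (by rw [AddSubgroupClass.coe_nsmul, hj]; rfl)
    clear hj
    induction j generalizing a with
    | zero => simpa using hpj
    | succ j ih =>
      have hb : p • (p ^ j • a) = 0 := by rw [← mul_nsmul', ← pow_succ', hpj]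
      have hbA : p ^ j • a ∈ A := by
        obtain ⟨ζ, ⟨k, hζk⟩, hζ⟩ := haA
        refine ⟨ζ ^ p ^ j, ⟨k, by rw [Units.val_pow_eq_pow_val, ← pow_mul, mul_comm, pow_mul, hζk, one_pow]⟩, ?_⟩
        rw [AddSubgroupClass.coe_nsmul, map_nsmul, hζ, ← map_nsmul, ofMul_pow]
      have hbfix : ∀ τ ∈ κ.kerSubgroup ⊓ decomp v, τ • (p ^ j • a) = p ^ j • a := fun τ hτ ↦ by
        rw [smul_comm, hfix τ hτ]
      have hb0 : p ^ j • a = 0 := hF2p _ hbA hb hbfix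
      exact ih a haA hfix hb0
  -- conclude by §1
  refine smul_eq_of_fixed_inf_of_sub_mem κ.kerSubgroup (decomp v) (fun d hd n hn ↦ ?_) A hF2
    (fun d hd ↦ hF1 d hd P) hP
  refine ⟨?_, (decomp v).mul_mem ((decomp v).mul_mem ((decomp v).inv_mem hd) hn.2) hd⟩
  have := Subgroup.Normal.conj_mem (inferInstanceAs κ.kerSubgroup.Normal) n hn.1 d⁻¹
  simpa using this

/-- **`E[p^∞]^{Gal(K̄/K_∞) ⊓ D_v} = E[p^∞]^{D_v}`** at a split multiplicative place with `μ_p(K_v) = 1` and a tame exponent on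
`E[p]` (iff form of the theorem). [cite: SilvermanATAEC1994, Thm. V.5.3] [cite: GreenbergLNM1716, §3 Lemma 3.3] -/
theorem geomPrimaryTorsion_fixed_kerSubgroup_inf_decomp_iff_of_split (v : HeightOneSpectrum (𝓞 K))
    (hsplit : W.HasSplitMultiplicativeReductionAt v)
    (hμ : ∀ ζ : v.adicCompletion K, ζ ^ p = 1 → ζ = 1)
    (htame : ∀ σ ∈ decomp v, ∃ m : ℕ, p.Coprime m ∧ ∀ Q : geomTorsion W (p : ℤ), σ ^ m • Q = Q)
    (P : geomPrimaryTorsion W p) :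
    (∀ τ ∈ κ.kerSubgroup ⊓ decomp v, τ • P = P) ↔ ∀ σ ∈ decomp v, σ • P = P :=
  ⟨geomPrimaryTorsion_forall_decomp_smul_eq_of_split W κ v hsplit hμ htame P, fun h τ hτ ↦ h τ hτ.2⟩

/-- **THE ♯-CLAUSE AT A SPLIT MULTIPLICATIVE PLACE, EXPLICIT: `y_v = ∂b + χ`.**  Same hypotheses on `v`; `y ∈ H¹(Γ_K, E[p])`
with `ι_v(res_{H_v} y) = 0` (clause (b) of `…SharpLocal`).  For every cocycle `ψ` on `D_v` representing `y_v = res_{D_v} y`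
there are `b ∈ E[p^∞]` with `p·b` FIXED BY `D_v` (a `p`-division point of a point of `E(K_v)[p^∞]`) and `χ : D_v → E[p^∞]`
ADDITIVE, with `D_v`-FIXED `p`-TORSION values (in `E(K_v)[p]`), VANISHING on `H_v`, such that `ψ(σ) = (σ•b − b) + χ(σ)` on
`D_v`.  (Kummer form on `H_v` from `…SharpLocalKummer`; `p·b` is `D_v`-fixed by the theorem; `χ = ψ − ∂b` vanishes on
`H_v ⊴ D_v`, so its values are `H_v`-fixed, hence `D_v`-fixed by the tame transfer.)  I.e.
`B_v ⊆ δ_v(E(K_v)[p^∞]) + Hom(D_v/H_v, E(K_v)[p])`, `χ` factoring through `D_v/(D_v^p H_v)`, cyclic of order `≤ p`.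
[cite: GreenbergLNM1716, §3 Lemmas 3.1, 3.3] [cite: SilvermanATAEC1994, Thm. V.5.3] [cite: SerreGaloisCohomology1997, I.§2.6 (b)] -/
theorem exists_kummer_add_hom_of_sharp_clause_of_split (v : HeightOneSpectrum (𝓞 K))
    (hsplit : W.HasSplitMultiplicativeReductionAt v)
    (hμ : ∀ ζ : v.adicCompletion K, ζ ^ p = 1 → ζ = 1)
    (htame : ∀ σ ∈ decomp v, ∃ m : ℕ, p.Coprime m ∧ ∀ Q : geomTorsion W (p : ℤ), σ ^ m • Q = Q)
    (y : discreteH1 (absoluteGaloisGroup K) (geomTorsion W (p : ℤ)))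
    (hy : W.torsionToPrimaryH1Sub p (κ.kerSubgroup ⊓ decomp v)
      (ResKernel.resSubgroup (κ.kerSubgroup ⊓ decomp v) (geomTorsion W (p : ℤ)) y) = 0)
    (ψ : contOneCocycles (discreteTopRep (decomp v) (geomTorsion W (p : ℤ))))
    (hψ : oneCocycleClass _ ψ = ResKernel.resSubgroup (decomp v) (geomTorsion W (p : ℤ)) y) :
    ∃ (b : geomPrimaryTorsion W p) (χ : decomp v → geomPrimaryTorsion W p),
      (∀ σ ∈ decomp v, σ • (p • b) = p • b) ∧
      (∀ σ : decomp v, AddSubgroup.inclusion (geomTorsion_le_geomPrimaryTorsion W p) (ψ.1 σ) =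
        ((σ : absoluteGaloisGroup K) • b - b) + χ σ) ∧
      (∀ σ τ : decomp v, χ (σ * τ) = χ σ + χ τ) ∧
      (∀ σ : decomp v, ∀ d ∈ decomp v, d • χ σ = χ σ) ∧
      (∀ σ : decomp v, p • χ σ = 0) ∧
      (∀ σ : decomp v, (σ : absoluteGaloisGroup K) ∈ κ.kerSubgroup → χ σ = 0) := by
  set incl := AddSubgroup.inclusion (geomTorsion_le_geomPrimaryTorsion W p) with hincl
  have hle : κ.kerSubgroup ⊓ decomp v ≤ decomp v := inf_le_right
  -- the restriction of `ψ` to `H_v = ker κ ⊓ D_v`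
  set φ := contOneCocycles.pullback (subgroupInclusion hle)
    (resHomOfEquivariant (subgroupInclusion hle) (AddMonoidHom.id _) (fun _ _ ↦ rfl)) ψ with hφdef
  have hφval : ∀ x : (κ.kerSubgroup ⊓ decomp v : Subgroup (absoluteGaloisGroup K)),
      φ.1 x = ψ.1 (Subgroup.inclusion hle x) := fun x ↦ rfl
  have hφclass : oneCocycleClass _ φ =
      ResKernel.resSubgroup (κ.kerSubgroup ⊓ decomp v) (geomTorsion W (p : ℤ)) y := by
    rw [← ZpDescent.resOfLe_resSubgroup hle y, ← hψ]
    change _ = ContinuousCohomology.map _ _ 1 (oneCocycleClass _ ψ)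
    rw [map_oneCocycleClass]
  -- Kummer form of the clause on `H_v`
  obtain ⟨b, hbfix, hbval⟩ := exists_kummer_of_torsionToPrimaryH1Sub_eq_zero W p (κ.kerSubgroup ⊓ decomp v) φ
    (by rw [hφclass]; exact hy)
  -- `p • b` is `D_v`-fixed (tower torsion = level-0 torsion at a split place)
  have hpb : ∀ σ ∈ decomp v, σ • (p • b) = p • b :=
    geomPrimaryTorsion_forall_decomp_smul_eq_of_split W κ v hsplit hμ htame (p • b)
      (fun τ hτ ↦ hbfix ⟨τ, hτ⟩)
  set χ : decomp v → geomPrimaryTorsion W p := fun σ ↦ incl (ψ.1 σ) - ((σ : absoluteGaloisGroup K) • b - b)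
    with hχ
  have hψχ : ∀ σ : decomp v, incl (ψ.1 σ) = ((σ : absoluteGaloisGroup K) • b - b) + χ σ := fun σ ↦ by
    rw [hχ]; exact (add_sub_cancel _ _).symm
  -- `χ` vanishes on `H_v`
  have hχker : ∀ σ : decomp v, (σ : absoluteGaloisGroup K) ∈ κ.kerSubgroup → χ σ = 0 := by
    intro σ hσ
    have h := hbval ⟨σ, ⟨hσ, σ.2⟩⟩
    rw [hφval] at h
    have h' : incl (ψ.1 σ) = (σ : absoluteGaloisGroup K) • b - b := Subtype.ext (by
      rw [hincl, AddSubgroup.coe_inclusion]; exact h)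
    rw [hχ]
    exact sub_eq_zero.mpr h'
  -- `χ` is `p`-torsion
  have hχp : ∀ σ : decomp v, p • χ σ = 0 := by
    intro σ
    have h1 : p • incl (ψ.1 σ) = 0 := by
      rw [← map_nsmul]
      have : p • ψ.1 σ = 0 := Subtype.ext (by
        rw [AddSubgroupClass.coe_nsmul, ZeroMemClass.coe_zero]
        exact AddSubgroup.torsionBy.nsmul_iff.mp (ψ.1 σ).2)
      rw [this, map_zero]
    have h2 : p • ((σ : absoluteGaloisGroup K) • b - b) = 0 := by
      rw [smul_sub, smul_comm, hpb _ σ.2, sub_self]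
    rw [hχ]
    change p • (incl (ψ.1 σ) - ((σ : absoluteGaloisGroup K) • b - b)) = 0
    rw [smul_sub, h1, h2, sub_zero]
  -- twisted additivity of `χ` (both `ψ` and `σ ↦ σ•b − b` are cocycles)
  have hχcoc : ∀ σ τ : decomp v, χ (σ * τ) = χ σ + (σ : absoluteGaloisGroup K) • χ τ := by
    intro σ τ
    have hc := ψ.2 σ τ
    have hc' : incl (ψ.1 (σ * τ)) = incl (ψ.1 σ) + (σ : absoluteGaloisGroup K) • incl (ψ.1 τ) := by
      rw [hc, map_add]
      congr 1
    rw [hχ]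
    change incl (ψ.1 (σ * τ)) - (((σ * τ : decomp v) : absoluteGaloisGroup K) • b - b) =
      (incl (ψ.1 σ) - ((σ : absoluteGaloisGroup K) • b - b)) +
        (σ : absoluteGaloisGroup K) • (incl (ψ.1 τ) - ((τ : absoluteGaloisGroup K) • b - b))
    rw [hc', Subgroup.coe_mul, mul_smul, smul_sub, smul_sub]
    abel
  -- values of `χ` are `H_v`-fixed, hence `D_v`-fixed (tame transfer on `E[p]`)
  have hχfix : ∀ σ : decomp v, ∀ d ∈ decomp v, d • χ σ = χ σ := by
    intro σ d hd
    have hHfix : ∀ τ ∈ κ.kerSubgroup ⊓ decomp v, τ • χ σ = χ σ := by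
      intro τ hτ
      -- `τ σ = σ (σ⁻¹ τ σ)` with `σ⁻¹ τ σ ∈ H_v`
      have hτ' : ((σ : absoluteGaloisGroup K))⁻¹ * τ * σ ∈ κ.kerSubgroup ⊓ decomp v := by
        refine ⟨?_, (decomp v).mul_mem ((decomp v).mul_mem ((decomp v).inv_mem σ.2) hτ.2) σ.2⟩
        have := Subgroup.Normal.conj_mem (inferInstanceAs κ.kerSubgroup.Normal) τ hτ.1 (σ : absoluteGaloisGroup K)⁻¹
        simpa using this
      have h1 := hχcoc ⟨τ, hτ.2⟩ σ
      have h2 := hχcoc σ ⟨(σ : absoluteGaloisGroup K)⁻¹ * τ * σ, hτ'.2⟩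
      have heq : (⟨τ, hτ.2⟩ : decomp v) * σ = σ * ⟨(σ : absoluteGaloisGroup K)⁻¹ * τ * σ, hτ'.2⟩ :=
        Subtype.ext (by simp [mul_assoc])
      rw [heq, h2, hχker ⟨_, hτ'.2⟩ hτ'.1, hχker ⟨τ, hτ.2⟩ hτ.1, smul_zero, add_zero, zero_add] at h1
      exact h1.symm
    obtain ⟨m, hm, hσm⟩ := htame d hd
    refine geomPrimaryTorsion_smul_eq_of_forall_kerSubgroup_inf_decomp W κ v (χ σ) hHfix hd hm ?_
    have hmem : ((χ σ : geomPrimaryTorsion W p) : geomPoints W) ∈ geomTorsion W (p : ℤ) :=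
      AddSubgroup.torsionBy.nsmul_iff.mpr (by
        rw [← AddSubgroupClass.coe_nsmul, hχp σ, ZeroMemClass.coe_zero])
    have := hσm ⟨_, hmem⟩
    apply Subtype.ext
    rw [primaryComponent.coe_smul]
    simpa [Literature.NumberTheory.EllipticCurves.AddSubgroup.torsionBy.coe_smul] using congrArg Subtype.val this
  refine ⟨b, χ, hpb, hψχ, fun σ τ ↦ ?_, hχfix, hχp, hχker⟩
  rw [hχcoc, hχfix τ σ σ.2]

end Split

/-! ### §3 Over `ℚ`, `E[p]` irreducible and `ρ̄_{E,p}` not onto (tameness automatic): tower torsion at split places,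
and the ♯0 door with the split-place clause made explicit -/

section OverQ

variable (W : WeierstrassCurve ℚ) [W.IsElliptic] (p : ℕ) [Fact p.Prime]

/-- **♯0 WITH LEVEL-0 CLAUSES AT `T` AND EXPLICIT KUMMER CLAUSES AT THE SPLIT PLACES `T'`.**  `E/ℚ`, `E[p]` irreducible,
`ρ̄_{E,p}` not onto; displayed: `T` = places with `E(ℚ_v)[p] = 0`, `T'` = split multiplicative places with `μ_p(ℚ_v) = 1`.
If for every cyclotomic `κ` every `y ∈ H¹(G_ℚ, E[p]; S)` satisfying the ♯-clause (b) everywhere, «`y_v = 0`» at `v ∈ T`, and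
«`y_v = ∂b + χ`» (as in `exists_kummer_add_hom_of_sharp_clause_of_split`) at `v ∈ T'` is `0`, then statement (A) holds at
the pair.  All extra clauses are consequences of (b), so the engine may use them.  On the route's domain use it with
`hX.irr` (`hX : ClassX11a W p`).  PROVED, no named fact; nothing asserted about any curve. [cite: CoatesSujatha2005, §3 statement (A)] [cite: GreenbergLNM1716, §3 Lemmas 3.1–3.3]
[cite: SilvermanATAEC1994, Thm. V.5.3] [cite: DeoRaySujatha2023, §3 (c1)–(c3)] -/
theorem conjAAt_of_irr_of_not_surj_of_forall_local_levelZero_split (hirr : W.HasIrreducibleModPGaloisRep p)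
    (hns : ¬ W.HasSurjectiveModNGaloisRep p) (T T' : Set (HeightOneSpectrum (𝓞 ℚ)))
    (hT : ∀ v ∈ T, ∀ P : geomTorsion W (p : ℤ), (∀ σ ∈ decomp v, σ • P = P) → P = 0)
    (hT' : ∀ v ∈ T', W.HasSplitMultiplicativeReductionAt v ∧ ∀ ζ : v.adicCompletion ℚ, ζ ^ p = 1 → ζ = 1)
    (hcert : ∀ κ : ZpExtension ℚ p, κ.IsCyclotomic →
      ∀ y : discreteH1 (absoluteGaloisGroup ℚ) (geomTorsion W (p : ℤ)),
        y ∈ h1Unramified (geomTorsion W (p : ℤ)) (W.badPlaces (𝓞 ℚ) ∪ {v | ((p : ℤ) : 𝓞 ℚ) ∈ v.asIdeal}) →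
        (∀ v : HeightOneSpectrum (𝓞 ℚ),
          W.torsionToPrimaryH1Sub p (κ.kerSubgroup ⊓ decomp v)
            (ResKernel.resSubgroup (κ.kerSubgroup ⊓ decomp v) (geomTorsion W (p : ℤ)) y) = 0) →
        (∀ v ∈ T, ResKernel.resSubgroup (decomp v) (geomTorsion W (p : ℤ)) y = 0) →
        (∀ v ∈ T', ∀ ψ : contOneCocycles (discreteTopRep (decomp v) (geomTorsion W (p : ℤ))),
          oneCocycleClass _ ψ = ResKernel.resSubgroup (decomp v) (geomTorsion W (p : ℤ)) y →
          ∃ (b : geomPrimaryTorsion W p) (χ : decomp v → geomPrimaryTorsion W p),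
            (∀ σ ∈ decomp v, σ • (p • b) = p • b) ∧
            (∀ σ : decomp v, AddSubgroup.inclusion (geomTorsion_le_geomPrimaryTorsion W p) (ψ.1 σ) =
              ((σ : absoluteGaloisGroup ℚ) • b - b) + χ σ) ∧
            (∀ σ τ : decomp v, χ (σ * τ) = χ σ + χ τ) ∧
            (∀ σ : decomp v, ∀ d ∈ decomp v, d • χ σ = χ σ) ∧
            (∀ σ : decomp v, p • χ σ = 0) ∧
            (∀ σ : decomp v, (σ : absoluteGaloisGroup ℚ) ∈ κ.kerSubgroup → χ σ = 0)) →
        y = 0) :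
    ConjAAt W p := by
  obtain ⟨m, hm, hσm⟩ := exists_tameExponent_of_irr_of_not_surj W p hirr hns
  refine conjAAt_of_irr_of_not_surj_of_forall_local_levelZero W p hirr hns T hT
    fun κ hκ y hunr hloc hT0 ↦ hcert κ hκ y hunr hloc hT0 fun v hv ψ hψ ↦ ?_
  exact exists_kummer_add_hom_of_sharp_clause_of_split W κ v (hT' v hv).1 (hT' v hv).2
    (fun σ _ ↦ ⟨m, hm, hσm σ⟩) y (hloc v) ψ hψ

end OverQ

end Summit.BirchSwinnertonDyer.BirchSwinnertonDyer.Theorems.UpperNonSurjThreeSharp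

end
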